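/-
Origin: expansion seat `planner-pub-hodgecm-toy2-g5-0`, handover #5 2026-08-18T08:59:49Z (`HOME/pub-hodgecm-toy2-g5/lean/Toy2g5/ToyPadH0Two.lean`, md5 74701cde, 164 lines);
landed by the gen-7 packager in gate run 27 as `HodgeCM/Model/Toy/ToyPadH0Two.lean` (import ^import Toy2g5\.PadH0Two\b→import HodgeCM.Model.PadH0Two ×1; stripped 3 #print/#check/#eval lines).
-/
/-
Copyright: pub-hodgecm formalisation cell (harness21, 2026). New file (not vendored).
Origin: HOME/pub-hodgecm-toy2-g5/lean/Toy2g5/ToyPadH0Two.lean — session planner-pub-hodgecm-toy2-g5-0 (unit pub-hodgecm-toy2-g5,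
CONSISTENCY seat 2, part (6a)(ii), generation 5).  WIP module `Toy2g5.ToyPadH0Two`; intended final place
`HodgeCM/Model/Toy/ToyPadH0Two.lean` (module `HodgeCM.Model.Toy.ToyPadH0Two`).  ONE import to rewrite on landing:
`Toy2g5.PadH0Two` ↦ `HodgeCM.Model.PadH0Two`.
-/
import Summits.HodgeConjecture.HodgeCM.Model.PadH0Two
import Summits.HodgeConjecture.HodgeCM.Model.Toy.ToyGysinDescent
import Summits.HodgeConjecture.HodgeCM.Model.Toy.ToyFFacts
import Summits.HodgeConjecture.HodgeCM.Model.ToyPerL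

/-!
# N3 `Fact_pull_H0` is independent, and load-bearing for `PohlmannSpan`: the model `toyModel♭²`

`twoPadModel := toyModel.padH0 toyModel.padDatumTwo` (`HodgeCM.Model.PadH0Two` applied to the exterior toy universe
`HodgeCM.Toy.toyModel`).  The extra pad law `Fact_cmDominated1` (M14 with domination degree `N = 1`) holds in the exterior
model for every Hodge datum: its M14 witnesses `s`, `π` (`Model/Toy/Isogeny.lean`) are inverse ISOMORPHISMS
(`sHom_comp_piHom`).  Truth table (each row a theorem below or in the files cited):

| statement                                   | `toyModel` | `twoPadModel` |
|---------------------------------------------|:----------:|:-------------:|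
| `ModelAxioms` (M1–M28)                      | true       | true          |
| N1 `Fact_cupExterior`, N2 `Fact_cup_hodge`  | true       | true          |
| **N3 `Fact_pull_H0`**                       | true       | **false**     |
| N4 `Fact_hodge_F0`                          | true       | true          |
| F4 `Fact_cupAlg`, F5 `Fact_cupAssoc`        | true       | true          |
| `Fact_dimProd`, `W_RK4`                     | true       | true          |
| **`PohlmannSpan`**                          | true       | **false**     |
| **`HC_CM`** (COR-CM)                        | true       | **false**     |

Headlines: `HodgeCM.Toy.fact_pull_H0_independent` — N3 is independent of
`ModelAxioms ∧ N1 ∧ N2 ∧ N4 ∧ F4 ∧ F5 ∧ Fact_dimProd ∧ W_RK4` (both truth values realised);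
`HodgeCM.Toy.not_pohlmannSpan_of_others₃` — Pohlmann's span inclusion does not follow from that conjunction (so the
hypothesis N3 of `pohlmannSpan_of_facts` carries content), and neither does COR-CM.  Nothing is cited; Lean + Mathlib
axioms only.
-/

noncomputable section

namespace HodgeCM.Toy

open Literature.AlgebraicGeometry.Motives (CMType)
open Universe exteriorPower

section

variable (D : HodgeData)

/-- **`Fact_cmDominated1` in the exterior model** (any Hodge datum), from a Galois CM oracle: the M14 witnesses
`s : A_{(K,Φ)} → A_{(F, Φ_F)}`, `π` of `Model/Toy/Isogeny.lean` compose to the identity (`sHom_comp_piHom`), so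
`(π ∘ s)^* = 1` in every degree. -/
theorem fact_cmDominated1 (O : GaloisCMOracle) : (toyModelWith D).Fact_cmDominated1 := by
  rintro X ⟨K, Φ, rfl⟩
  refine ⟨O.F K, O.gal K, O.six K, 0, fun _ => inducedType K (O.F K) (O.emb K) Φ,
    sHom K (O.F K) (O.emb K) Φ, piHom K (O.F K) (O.emb K) Φ, fun k => ?_⟩
  change map k ((sHom K (O.F K) (O.emb K) Φ).comp (piHom K (O.F K) (O.emb K) Φ)).lin = _
  rw [sHom_comp_piHom]
  exact map_id

end

/-- **`Fact_cmDominated1` holds in `toyModel`** (oracle: the constructed `galoisCMOracle`). -/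
theorem toyModel_fact_cmDominated1 : toyModel.Fact_cmDominated1 := fact_cmDominated1 exteriorHodgeData galoisCMOracle

/-- **The `H²`-padded toy universe** `toyModel♭²`: `H⁰(X) ↦ H⁰(X) ⊕ H²(X)`, the pad purely of type `(0,0)` with the pad
action `f^*|_{H²}`. -/
def twoPadModel : Universe := toyModel.padH0 toyModel.padDatumTwo

/-- (Ported verbatim from the HodgeCMPerL package; no docstring in the source.) -/
theorem twoPadModel_def : twoPadModel = toyModel.padH0 toyModel.padDatumTwo := rfl

/-- (Ported verbatim from the HodgeCMPerL package; no docstring in the source.) -/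
theorem twoPadModel_modelAxioms : twoPadModel.ModelAxioms :=
  PadH0Two.modelAxioms toyModel_modelAxioms toyModel_fact_dimProd toyModel_fact_cmDominated1

/-- (Ported verbatim from the HodgeCMPerL package; no docstring in the source.) -/
theorem twoPadModel_fact_cupExterior : twoPadModel.Fact_cupExterior :=
  PadH0Two.fact_cupExterior_iff.mpr toyModel_fact_cupExterior

/-- (Ported verbatim from the HodgeCMPerL package; no docstring in the source.) -/
theorem twoPadModel_fact_cup_hodge : twoPadModel.Fact_cup_hodge := PadH0Two.fact_cup_hodge toyModel_fact_cup_hodge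

/-- (Ported verbatim from the HodgeCMPerL package; no docstring in the source.) -/
theorem twoPadModel_fact_hodge_F0 : twoPadModel.Fact_hodge_F0 := PadH0Two.fact_hodge_F0 toyModel_fact_hodge_F0

/-- (Ported verbatim from the HodgeCMPerL package; no docstring in the source.) -/
theorem twoPadModel_fact_cupAlg : twoPadModel.Fact_cupAlg := PadH0Two.fact_cupAlg fact_cupAlg

/-- (Ported verbatim from the HodgeCMPerL package; no docstring in the source.) -/
theorem twoPadModel_fact_cupAssoc : twoPadModel.Fact_cupAssoc := PadH0Two.fact_cupAssoc (fact_cupAssoc exteriorHodgeData)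

/-- (Ported verbatim from the HodgeCMPerL package; no docstring in the source.) -/
theorem twoPadModel_fact_dimProd : twoPadModel.Fact_dimProd := PadH0Two.fact_dimProd_iff.mpr toyModel_fact_dimProd

/-- (Ported verbatim from the HodgeCMPerL package; no docstring in the source.) -/
theorem twoPadModel_w_rk4 : twoPadModel.W_RK4 := PadH0Two.w_RK4_iff.mpr toyModel_w_rk4

/-- **N3 fails in `toyModel♭²`.** -/
theorem not_twoPadModel_fact_pull_H0 : ¬ twoPadModel.Fact_pull_H0 :=
  PadH0Two.not_fact_pull_H0 toyModel_modelAxioms toyModel_fact_dimProd toyModel_fact_cmDominated1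
    toyModel_fact_cupExterior toyModel_fact_cup_hodge toyModel_fact_hodge_F0

/-- **Pohlmann's span inclusion fails in `toyModel♭²`.** -/
theorem not_twoPadModel_pohlmannSpan : ¬ twoPadModel.PohlmannSpan :=
  PadH0Two.not_pohlmannSpan toyModel_modelAxioms toyModel_fact_cupExterior

/-- **COR-CM fails in `toyModel♭²`.** -/
theorem not_twoPadModel_hc_cm : ¬ twoPadModel.HC_CM := PadH0Two.not_hc_cm toyModel_modelAxioms toyModel_fact_cupExterior

/-- The full profile of `toyModel♭²`. -/
theorem twoPadModel_profile :
    twoPadModel.ModelAxioms ∧ twoPadModel.Fact_dimProd ∧ twoPadModel.Fact_cupExterior ∧ twoPadModel.Fact_cup_hodge ∧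
      twoPadModel.Fact_hodge_F0 ∧ twoPadModel.Fact_cupAlg ∧ twoPadModel.Fact_cupAssoc ∧ twoPadModel.W_RK4 ∧
      ¬ twoPadModel.Fact_pull_H0 ∧ ¬ twoPadModel.PohlmannSpan ∧ ¬ twoPadModel.HC_CM :=
  ⟨twoPadModel_modelAxioms, twoPadModel_fact_dimProd, twoPadModel_fact_cupExterior, twoPadModel_fact_cup_hodge,
    twoPadModel_fact_hodge_F0, twoPadModel_fact_cupAlg, twoPadModel_fact_cupAssoc, twoPadModel_w_rk4,
    not_twoPadModel_fact_pull_H0, not_twoPadModel_pohlmannSpan, not_twoPadModel_hc_cm⟩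

/-- **N3 `Fact_pull_H0` is INDEPENDENT of `ModelAxioms ∧ N1 ∧ N2 ∧ N4 ∧ F4 ∧ F5 ∧ Fact_dimProd ∧ W_RK4`**: both truth
values are realised (`toyModel`: true; `toyModel♭²`: false). -/
theorem fact_pull_H0_independent :
    (∃ U : Universe, (U.ModelAxioms ∧ U.Fact_cupExterior ∧ U.Fact_cup_hodge ∧ U.Fact_hodge_F0 ∧ U.Fact_cupAlg ∧
      U.Fact_cupAssoc ∧ U.Fact_dimProd ∧ U.W_RK4) ∧ U.Fact_pull_H0) ∧
    (∃ U : Universe, (U.ModelAxioms ∧ U.Fact_cupExterior ∧ U.Fact_cup_hodge ∧ U.Fact_hodge_F0 ∧ U.Fact_cupAlg ∧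
      U.Fact_cupAssoc ∧ U.Fact_dimProd ∧ U.W_RK4) ∧ ¬ U.Fact_pull_H0) :=
  ⟨⟨toyModel, ⟨toyModel_modelAxioms, toyModel_fact_cupExterior, toyModel_fact_cup_hodge, toyModel_fact_hodge_F0,
      fact_cupAlg, fact_cupAssoc exteriorHodgeData, toyModel_fact_dimProd, toyModel_w_rk4⟩, toyModel_fact_pull_H0⟩,
    ⟨twoPadModel, ⟨twoPadModel_modelAxioms, twoPadModel_fact_cupExterior, twoPadModel_fact_cup_hodge,
      twoPadModel_fact_hodge_F0, twoPadModel_fact_cupAlg, twoPadModel_fact_cupAssoc, twoPadModel_fact_dimProd,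
      twoPadModel_w_rk4⟩, not_twoPadModel_fact_pull_H0⟩⟩

/-- **Pohlmann's span inclusion is not a consequence of `ModelAxioms ∧ N1 ∧ N2 ∧ N4 ∧ F4 ∧ F5 ∧ Fact_dimProd ∧ W_RK4`**
— the hypothesis N3 of `pohlmannSpan_of_facts` carries content. -/
theorem not_pohlmannSpan_of_others₃ :
    ¬ ∀ U : Universe, U.ModelAxioms → U.Fact_cupExterior → U.Fact_cup_hodge → U.Fact_hodge_F0 → U.Fact_cupAlg →
      U.Fact_cupAssoc → U.Fact_dimProd → U.W_RK4 → U.PohlmannSpan :=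
  fun h => not_twoPadModel_pohlmannSpan (h twoPadModel twoPadModel_modelAxioms twoPadModel_fact_cupExterior
    twoPadModel_fact_cup_hodge twoPadModel_fact_hodge_F0 twoPadModel_fact_cupAlg twoPadModel_fact_cupAssoc
    twoPadModel_fact_dimProd twoPadModel_w_rk4)

/-- … nor is COR-CM. -/
theorem not_hc_cm_of_others₃ :
    ¬ ∀ U : Universe, U.ModelAxioms → U.Fact_cupExterior → U.Fact_cup_hodge → U.Fact_hodge_F0 → U.Fact_cupAlg →
      U.Fact_cupAssoc → U.Fact_dimProd → U.W_RK4 → U.HC_CM :=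
  fun h => not_twoPadModel_hc_cm (h twoPadModel twoPadModel_modelAxioms twoPadModel_fact_cupExterior
    twoPadModel_fact_cup_hodge twoPadModel_fact_hodge_F0 twoPadModel_fact_cupAlg twoPadModel_fact_cupAssoc
    twoPadModel_fact_dimProd twoPadModel_w_rk4)

/-- … in particular N3 is not a consequence of the other hypotheses of `pohlmannSpan_of_facts` and `Fact_dimProd`. -/
theorem not_fact_pull_H0_of_others :
    ¬ ∀ U : Universe, U.ModelAxioms → U.Fact_cupExterior → U.Fact_cup_hodge → U.Fact_hodge_F0 → U.Fact_dimProd →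
      U.Fact_pull_H0 :=
  fun h => not_twoPadModel_fact_pull_H0 (h twoPadModel twoPadModel_modelAxioms twoPadModel_fact_cupExterior
    twoPadModel_fact_cup_hodge twoPadModel_fact_hodge_F0 twoPadModel_fact_dimProd)

/-- `toyModel♭²` is a new model of the 28 facts (it differs from `toyModel` on N3). -/
theorem twoPadModel_ne_toyModel : twoPadModel ≠ toyModel :=
  fun h => not_twoPadModel_fact_pull_H0 (h ▸ toyModel_fact_pull_H0)

/-- By-product (`PadH0Two.exists_pull_two_ne_id` on `toyModel`): some toy endomorphism acts non-trivially on some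
`H² = ⋀² L_X` — obtained purely from the transfer theorems, without naming one. -/
theorem toyModel_exists_pull_two_ne_id : ∃ (X : toyModel.Var) (f : toyModel.Mor X X), toyModel.pull f 2 ≠ LinearMap.id :=
  PadH0Two.exists_pull_two_ne_id toyModel_modelAxioms toyModel_fact_dimProd toyModel_fact_cmDominated1
    toyModel_fact_cupExterior toyModel_fact_cup_hodge toyModel_fact_pull_H0 toyModel_fact_hodge_F0


end HodgeCM.Toy

end
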